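import Literature.Barriers.CriticalPhenomena.LongRangeTrivialityOnZ3TwoPoint
import Literature.Barriers.CriticalPhenomena.LongRangeTrivialityOnZ3LatticeSums
import HarnessLib

/-!
# Audit (D-0021, generation 4) of `LongRangeTrivialityOnZ3Proofs.lean`, companion: the reflected-current
# lower bound of Duminil-Copin–Panis (2025, Theorem 1.3) forces `χ_L(β)² ≥ cL³` infinitely often on `ℤ³`
# — the nearest-neighbour model is outside the reach of the tree-diagram mechanism (proved modulo the
# printed nearest-neighbour inputs, stated as hypotheses)

Barrier catalogue `Literature/Barriers/CriticalPhenomena/` (D-0021), sub-problem `Ising3DConformalLimit`.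
Companion of the generation-4 audit record `LongRangeTrivialityOnZ3SusceptibilityAudit.lean` (refuter,
barrier-audit mode, 2026-08-15), which proves that the tree-diagram mechanism behind the barriers
`LongRangeTrivialityOnZ3` ⊂ `BubbleTrivialityOnZ3` ⊂ `SusceptibilityTrivialityOnZ3` reaches EXACTLY the
ferromagnets with `χ_L(β_c)²/L³ → 0` (MMS2 granted), and isolates the necessary condition for a
non-Gaussian critical smearing: `χ_L(β_c)² ≥ cL³` for some `c > 0` and infinitely many `L`
(`hasNonGaussianSmearingZ3_member_imp_frequently`). That record asserts — as a paper derivation — that the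
nearest-neighbour model on `ℤ³` satisfies this condition by Theorem 1.3 of Duminil-Copin–Panis with the
Messager–Miracle-Solé inequalities. THIS file turns the derivation into a theorem: the analytic half is
proved in Lean for every ferromagnetic pair interaction on `ℤ³`, the three printed nearest-neighbour inputs
entering as hypotheses (they concern the nearest-neighbour DLR state, which is not bridged to
`LongRangeIsing.state (nnCoupling 3)` in the tree). No definition, no named fact (D-0026).

## What the source prints (arXiv:2404.05700 = CMP 406 (2025), held text pp. 3–6)

* §1, footnote on the MMS inequalities: "(i) the sequence `(⟨τ₀τ_{ke₁}⟩_β)_{k≥0}` is decreasing; (ii) for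
  any `x ∈ ℤ^d`, one has `⟨τ₀τ_{(|x|₁,0_⊥)}⟩_β ≤ ⟨τ₀τ_x⟩_β ≤ ⟨τ₀τ_{(|x|,0_⊥)}⟩_β`, where `|·|₁` denotes
  the `ℓ¹` norm" (and `|·|` the sup norm). [cite: DuminilCopinPanis2025LowerBounds, §1 (footnote on the MMS inequalities)]
* "Theorem 1.3. Let `d ≥ 3`. There exist `c₁, N₁ > 0` such that for all `β ≤ β_c` and for all
  `N₁ ≤ n ≤ L(β)`, `⟨τ₀τ_{ne₁}⟩_β ≥ c₁/(χ_{4n}(β) + n^{d-2}∑_{1≤k≤2n}k⟨τ₀τ_{ke₁}⟩_β)`", `L(β)` the sharp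
  length of Definition 1.1 (infinite at `β_c`, where the printed proof of Theorem 1.8 applies Theorem 1.2
  "for `n` large enough"), `χ_n(β) = ∑_{x∈Λ_n}⟨τ₀τ_x⟩_β`, `Λ_n = [-n,n]^d ∩ ℤ^d`.
  [cite: DuminilCopinPanis2025LowerBounds, Theorem 1.3]
* "When `d = 3` we do not obtain a more explicit pointwise lower bound, but we still improve on the
  existing bound on `η`. Theorem 1.5. Let `d = 3`. If the critical exponent `η` exists, it satisfies
  `η ≤ 1/2`. Proof. The proof follows by plugging the estimate provided by the existence of `η` in
  (lower bound always true)." [cite: DuminilCopinPanis2025LowerBounds, Theorem 1.5]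

## What is proved here (all theorems, namespace `LongRangeIsing`)

* `two_thirds_mul_sqrt_le_sum_Icc_sqrt` (`∑_{r≤m}√r ≥ (2/3)m√m`), `cube_div_three_le_sum_Icc_sq`
  (`∑_{r≤m}r² ≥ m³/3`); `∑_{k≤M}1/√k ≤ 2√M` is kept local to the main proof (it is already in the tree,
  `Literature.NumberTheory.LFunctions.sum_Icc_one_div_sqrt_le`, whose module is not imported here);
* `frequently_sq_le_of_dcp_lowerBound` — the SEQUENCE form: `s ≥ 0` antitone,
  `24∑_{r≤m}r²s_{3r} ≤ χ_m`, and `c₁ ≤ s_n(χ_{4n} + n∑_{k≤2n}ks_k)` for `n ≥ N₁` imply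
  `∃ c > 0, ∃ᶠ m, cm³ ≤ χ_m²` (`c = c₁/16`); the printed conditional statement `η ≤ 1/2` is its
  regularly-varying shadow;
* `boxSusceptibility_eq_sum_shells`, `mul_le_sum_shell` (the `ℓ^∞`-shell of radius `r ≥ 1` in `ℤ³` has
  `(2r+1)³ - (2r-1)³ = 24r² + 2` sites), `shellSum_le_boxSusceptibility` (MMS (ii) summed over shells:
  `24∑_{r≤m}r²⟨σ₀σ_{3re₁}⟩ ≤ χ_m`);
* `frequently_boxSusceptibility_sq_ge_of_dcp` — the MODEL form: for `J ≥ 0` on `ℤ³`, `β ≥ 0`, if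
  (i) `k ↦ ⟨σ₀σ_{ke₁}⟩_β` is antitone, (ii) `⟨σ₀σ_x⟩_β ≥ ⟨σ₀σ_{3‖x‖_∞e₁}⟩_β` (from the footnote:
  `|x|₁ ≤ 3‖x‖_∞` and (i)), and (iii) the inequality of Theorem 1.3 holds for all `n ≥ N₁` at `β`, then
  `χ_L(β)² ≥ cL³` for some `c > 0` and infinitely many `L` — for the nearest-neighbour model at `β_c`
  (i)–(iii) are the quoted theorems, so it meets the necessary condition of the generation-4 barrier and is
  outside the reach of the tree-diagram mechanism (whereas `B(β_c) = ∞` alone, Theorem 1.8, would not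
  place it there: see the companion record).

## References

* H. Duminil-Copin, R. Panis, *New lower bounds for the (near) critical Ising and φ⁴ models' two-point
  functions*, Commun. Math. Phys. 406 (2025), arXiv:2404.05700: §1 (MMS footnote), Definition 1.1,
  Theorems 1.3, 1.5, 1.8 [DuminilCopinPanis2025LowerBounds] (held; read pp. 3–7).
* A. Messager, S. Miracle-Solé, J. Stat. Phys. 17 (1977) (as cited there).

## Tree anchors

`pairCorrelation(_nonneg)`, `boxSusceptibility(_nonneg)` (`…TwoPoint`, `…Inputs`); `box_mono`, `card_box`,
`mem_box_iff_supNorm_le`, `Site.supNorm`; Mathlib: `Finset.sum_Icc_succ_top`, `Finset.sum_sdiff`,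
`Finset.card_sdiff_add_card_eq_card`, `Real.sq_sqrt`, `Real.sqrt_le_sqrt`, `Real.sqrt_mul`,
`pow_le_pow_iff_left₀`, `lt_of_pow_lt_pow_left₀`, `lt_of_mul_lt_mul_right`, `Filter.not_frequently`,
`Filter.eventually_atTop`, `exists_nat_ge`.
-/

noncomputable section

namespace Literature.Barriers.CriticalPhenomena

open Literature.Probability.LatticeModels Literature.Probability.Percolation Filter Topology Finset

namespace LongRangeIsing

/-! ### Two elementary sums -/

/-- `(2/3) m√m ≤ ∑_{r=1}^{m} √r`. [folklore] -/
theorem two_thirds_mul_sqrt_le_sum_Icc_sqrt (m : ℕ) :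
    2 / 3 * ((m : ℝ) * Real.sqrt m) ≤ ∑ r ∈ Finset.Icc 1 m, Real.sqrt r := by
  induction m with
  | zero => simp
  | succ n ih =>
    rw [Finset.sum_Icc_succ_top (Nat.le_add_left 1 n)]
    push_cast
    have hn : (0 : ℝ) ≤ n := Nat.cast_nonneg n
    have ha2 : Real.sqrt (n : ℝ) ^ 2 = n := Real.sq_sqrt hn
    have hb2 : Real.sqrt ((n : ℝ) + 1) ^ 2 = n + 1 := Real.sq_sqrt (by positivity)
    have ha0 : 0 ≤ Real.sqrt (n : ℝ) := Real.sqrt_nonneg _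
    have hb0 : 0 ≤ Real.sqrt ((n : ℝ) + 1) := Real.sqrt_nonneg _
    have key : (2 * (n : ℝ) - 1) * Real.sqrt ((n : ℝ) + 1) ≤ 2 * n * Real.sqrt (n : ℝ) := by
      rcases Nat.eq_zero_or_pos n with h0 | hpos
      · subst h0
        simp
      · have hn1 : (1 : ℝ) ≤ n := by exact_mod_cast hpos
        have h2 : 0 ≤ 2 * (n : ℝ) - 1 := by linarith
        apply (pow_le_pow_iff_left₀ (by positivity) (by positivity) two_ne_zero).1
        calc ((2 * (n : ℝ) - 1) * Real.sqrt ((n : ℝ) + 1)) ^ 2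
            = (2 * (n : ℝ) - 1) ^ 2 * Real.sqrt ((n : ℝ) + 1) ^ 2 := by ring
          _ = (2 * (n : ℝ) - 1) ^ 2 * (n + 1) := by rw [hb2]
          _ ≤ (2 * (n : ℝ)) ^ 2 * n := by nlinarith
          _ = (2 * (n : ℝ)) ^ 2 * Real.sqrt (n : ℝ) ^ 2 := by rw [ha2]
          _ = (2 * n * Real.sqrt (n : ℝ)) ^ 2 := by ring
    nlinarith [ih, key, hb0]

/-- `m³/3 ≤ ∑_{r=1}^{m} r²`. [folklore] -/
theorem cube_div_three_le_sum_Icc_sq (m : ℕ) : (m : ℝ) ^ 3 / 3 ≤ ∑ r ∈ Finset.Icc 1 m, (r : ℝ) ^ 2 := by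
  induction m with
  | zero => simp
  | succ n ih =>
    rw [Finset.sum_Icc_succ_top (Nat.le_add_left 1 n)]
    push_cast
    have hn : (0 : ℝ) ≤ n := Nat.cast_nonneg n
    nlinarith [ih, hn, sq_nonneg (n : ℝ)]

/-! ### The sequence form of the argument -/

/-- **The Duminil-Copin–Panis lower bound forces `χ_m² ≥ cm³` infinitely often** (sequence form). Let
`s ≥ 0` be antitone (the on-axis two-point function `s_k = ⟨σ₀σ_{ke₁}⟩_β`, MMS (i)) and let `χ_m`
dominate the shell sums, `24∑_{r≤m}r²s_{3r} ≤ χ_m` (MMS (ii) summed over the `ℓ^∞`-shells of `Λ_m`,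
which have `24r² + 2` sites). If `c₁ ≤ s_n(χ_{4n} + n∑_{k≤2n}ks_k)` for all `n ≥ N₁` (Theorem 1.3 of
Duminil-Copin–Panis at `β = β_c`, `d = 3`, `L(β_c) = ∞`), then `χ_m² ≥ cm³` for infinitely many `m`,
with `c = c₁/16`: otherwise, with `16ε² = c₁`, `χ_m < εm√m` eventually, whence `s_{3m}m√m ≤ ε/8`
(antitonicity and `∑_{r≤m}r² ≥ m³/3`), `s_k ≤ 2ε/(k√k)`, `∑_{k≤2n}ks_k ≤ A + 8ε√n` (`∑_{k≤M}1/√k ≤ 2√M`),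
`χ_{4n} + n∑_{k≤2n}ks_k ≤ 17εn√n`, so the lower bound gives `s_n ≥ c₁/(17εn√n)` and finally
`χ_m ≥ 24∑r²s_{3r} ≥ (4c₁/(17ε))(∑_{r≤m}√r - R₀√m) ≥ (4c₁/(51ε))m√m = (64/51)εm√m > εm√m`
(`∑_{r≤m}√r ≥ (2/3)m√m`), a contradiction — the lim-sup form of Theorem 1.5 ("if the critical exponent
`η` exists, it satisfies `η ≤ 1/2`"). [cite: DuminilCopinPanis2025LowerBounds, Theorem 1.3 and Theorem 1.5] -/
theorem frequently_sq_le_of_dcp_lowerBound {s χ : ℕ → ℝ} {c₁ : ℝ} (hc₁ : 0 < c₁) {N₁ : ℕ}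
    (hs0 : ∀ k, 0 ≤ s k) (hs : Antitone s)
    (hχs : ∀ m : ℕ, 24 * ∑ r ∈ Finset.Icc 1 m, (r : ℝ) ^ 2 * s (3 * r) ≤ χ m)
    (hdcp : ∀ n : ℕ, N₁ ≤ n →
      c₁ ≤ s n * (χ (4 * n) + n * ∑ k ∈ Finset.Icc 1 (2 * n), (k : ℝ) * s k)) :
    ∃ c : ℝ, 0 < c ∧ ∃ᶠ m : ℕ in atTop, c * (m : ℝ) ^ 3 ≤ χ m ^ 2 := by
  obtain ⟨ε, hε⟩ : ∃ ε : ℝ, ε = Real.sqrt c₁ / 4 := ⟨_, rfl⟩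
  -- two elementary facts, kept local (`√4 = 2`, `∑_{k≤M} 1/√k ≤ 2√M`)
  have sqrt_four : Real.sqrt 4 = 2 := by
    rw [show (4 : ℝ) = 2 ^ 2 by norm_num, Real.sqrt_sq (by norm_num)]
  have sum_Icc_one_div_sqrt_le : ∀ M : ℕ, ∑ k ∈ Finset.Icc 1 M, 1 / Real.sqrt k ≤ 2 * Real.sqrt M := by
    intro M
    induction M with
    | zero => simp
    | succ n ih =>
      rw [Finset.sum_Icc_succ_top (Nat.le_add_left 1 n)]
      push_cast
      have hn : (0 : ℝ) ≤ n := Nat.cast_nonneg n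
      have hb2 : Real.sqrt ((n : ℝ) + 1) ^ 2 = n + 1 := Real.sq_sqrt (by positivity)
      have ha0 : 0 ≤ Real.sqrt (n : ℝ) := Real.sqrt_nonneg _
      have hb0 : 0 < Real.sqrt ((n : ℝ) + 1) := Real.sqrt_pos.2 (by positivity)
      have hab : 2 * Real.sqrt (n : ℝ) * Real.sqrt ((n : ℝ) + 1) ≤ 2 * n + 1 := by
        nlinarith [sq_nonneg (Real.sqrt (n : ℝ) - Real.sqrt ((n : ℝ) + 1)), Real.sq_sqrt hn]
      have hstep : 1 / Real.sqrt ((n : ℝ) + 1) ≤ 2 * (Real.sqrt ((n : ℝ) + 1) - Real.sqrt (n : ℝ)) := by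
        rw [div_le_iff₀ hb0]
        nlinarith [hb2, hab]
      linarith [ih, hstep]
  have hε0 : 0 < ε := by rw [hε]; positivity
  have hε2 : 16 * ε ^ 2 = c₁ := by rw [hε, div_pow, Real.sq_sqrt hc₁.le]; ring
  refine ⟨ε ^ 2, by positivity, ?_⟩
  by_contra hnot
  rw [Filter.not_frequently] at hnot
  obtain ⟨n₀, hn₀⟩ := eventually_atTop.1 hnot
  -- `χ_m < ε m√m` for `m ≥ n₀`
  have hup : ∀ m : ℕ, n₀ ≤ m → χ m < ε * ((m : ℝ) * Real.sqrt m) := by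
    intro m hm
    have h := hn₀ m hm
    rw [not_le] at h
    have hm0 : (0 : ℝ) ≤ m := Nat.cast_nonneg m
    have e : ε ^ 2 * (m : ℝ) ^ 3 = (ε * ((m : ℝ) * Real.sqrt m)) ^ 2 := by
      rw [mul_pow, mul_pow, Real.sq_sqrt hm0]; ring
    rw [e] at h
    exact lt_of_pow_lt_pow_left₀ 2 (by positivity) h
  -- Step A: `s_{3m} m√m ≤ ε/8`
  have hstepA : ∀ m : ℕ, n₀ ≤ m → 1 ≤ m → s (3 * m) * ((m : ℝ) * Real.sqrt m) ≤ ε / 8 := by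
    intro m hm hm1
    have hm0 : (0 : ℝ) < m := by exact_mod_cast hm1
    obtain ⟨u, hu⟩ : ∃ u : ℝ, u = (m : ℝ) * Real.sqrt m := ⟨_, rfl⟩
    have hu0 : 0 < u := by rw [hu]; positivity
    have hu2 : u ^ 2 = (m : ℝ) ^ 3 := by rw [hu, mul_pow, Real.sq_sqrt hm0.le]; ring
    have hs3 : 0 ≤ s (3 * m) := hs0 _
    have h1 : s (3 * m) * ∑ r ∈ Finset.Icc 1 m, (r : ℝ) ^ 2 ≤ ∑ r ∈ Finset.Icc 1 m, (r : ℝ) ^ 2 * s (3 * r) := by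
      rw [Finset.mul_sum]
      refine Finset.sum_le_sum fun r hr => ?_
      have hrm : 3 * r ≤ 3 * m := Nat.mul_le_mul_left 3 (Finset.mem_Icc.1 hr).2
      rw [mul_comm]
      exact mul_le_mul_of_nonneg_left (hs hrm) (sq_nonneg _)
    have h2 := cube_div_three_le_sum_Icc_sq m
    have h3 : 24 * ∑ r ∈ Finset.Icc 1 m, (r : ℝ) ^ 2 * s (3 * r) < ε * u := by
      rw [hu]; exact (hχs m).trans_lt (hup m hm)
    have h4 : 8 * s (3 * m) * u ^ 2 < ε * u := by
      calc 8 * s (3 * m) * u ^ 2 = 24 * (s (3 * m) * ((m : ℝ) ^ 3 / 3)) := by rw [hu2]; ring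
        _ ≤ 24 * (s (3 * m) * ∑ r ∈ Finset.Icc 1 m, (r : ℝ) ^ 2) := by gcongr
        _ ≤ 24 * ∑ r ∈ Finset.Icc 1 m, (r : ℝ) ^ 2 * s (3 * r) := by linarith [h1]
        _ < ε * u := h3
    have h5 : 8 * s (3 * m) * u < ε := by
      have h6 : 8 * s (3 * m) * u * u < ε * u := by
        calc 8 * s (3 * m) * u * u = 8 * s (3 * m) * u ^ 2 := by ring
          _ < ε * u := h4
      exact lt_of_mul_lt_mul_right h6 hu0.le
    rw [← hu]
    linarith
  -- Step B: `s_k k√k ≤ 2ε` for `k ≥ 3(n₀+1)`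
  have hstepB : ∀ k : ℕ, 3 * (n₀ + 1) ≤ k → s k * ((k : ℝ) * Real.sqrt k) ≤ 2 * ε := by
    intro k hk
    obtain ⟨q, hq⟩ : ∃ q : ℕ, q = k / 3 := ⟨_, rfl⟩
    have hq1 : n₀ + 1 ≤ q := by rw [hq]; exact (Nat.le_div_iff_mul_le (by norm_num)).2 (by omega)
    have h3q : 3 * q ≤ k := by rw [hq]; exact Nat.mul_div_le k 3
    have hk6q : k ≤ 6 * q := by rw [hq]; omega
    have hsk : s k ≤ s (3 * q) := hs h3q
    have hA := hstepA q (by omega) (by omega)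
    have hq0 : (0 : ℝ) < q := by exact_mod_cast (show 0 < q by omega)
    have hk0 : (0 : ℝ) ≤ k := Nat.cast_nonneg k
    have hv : (k : ℝ) * Real.sqrt k ≤ 15 * ((q : ℝ) * Real.sqrt q) := by
      apply (pow_le_pow_iff_left₀ (by positivity) (by positivity) two_ne_zero).1
      have e1 : ((k : ℝ) * Real.sqrt k) ^ 2 = (k : ℝ) ^ 3 := by rw [mul_pow, Real.sq_sqrt hk0]; ring
      have e2 : (15 * ((q : ℝ) * Real.sqrt q)) ^ 2 = 225 * (q : ℝ) ^ 3 := by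
        rw [mul_pow, mul_pow, Real.sq_sqrt hq0.le]; ring
      rw [e1, e2]
      have h6 : (k : ℝ) ≤ 6 * q := by exact_mod_cast hk6q
      calc (k : ℝ) ^ 3 ≤ (6 * (q : ℝ)) ^ 3 := pow_le_pow_left₀ hk0 h6 3
        _ = 216 * (q : ℝ) ^ 3 := by ring
        _ ≤ 225 * (q : ℝ) ^ 3 := by nlinarith [pow_pos hq0 3]
    calc s k * ((k : ℝ) * Real.sqrt k) ≤ s (3 * q) * ((k : ℝ) * Real.sqrt k) :=
        mul_le_mul_of_nonneg_right hsk (by positivity)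
      _ ≤ s (3 * q) * (15 * ((q : ℝ) * Real.sqrt q)) := mul_le_mul_of_nonneg_left hv (hs0 _)
      _ = 15 * (s (3 * q) * ((q : ℝ) * Real.sqrt q)) := by ring
      _ ≤ 15 * (ε / 8) := by gcongr
      _ ≤ 2 * ε := by linarith
  -- Step C: `∑_{k≤M} k s_k ≤ K² s₀ + 4ε√M`, `K = 3(n₀+1)`
  obtain ⟨K, hK⟩ : ∃ K : ℕ, K = 3 * (n₀ + 1) := ⟨_, rfl⟩
  have hKs0 : 0 ≤ (K : ℝ) * s 0 := mul_nonneg (Nat.cast_nonneg K) (hs0 0)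
  have hstepC : ∀ M : ℕ, ∑ k ∈ Finset.Icc 1 M, (k : ℝ) * s k ≤ (K : ℝ) * K * s 0 + 4 * ε * Real.sqrt M := by
    intro M
    have hterm : ∀ k ∈ Finset.Icc 1 M,
        (k : ℝ) * s k ≤ (if k ≤ K then (K : ℝ) * s 0 else 0) + 2 * ε * (1 / Real.sqrt k) := by
      intro k hk
      have hk1 : 1 ≤ k := (Finset.mem_Icc.1 hk).1
      have hk0 : (0 : ℝ) < k := by exact_mod_cast hk1
      by_cases hkK : k ≤ K
      · rw [if_pos hkK]
        have h1 : (k : ℝ) * s k ≤ K * s 0 :=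
          mul_le_mul (by exact_mod_cast hkK) (hs (Nat.zero_le k)) (hs0 k) (Nat.cast_nonneg K)
        have h2 : 0 ≤ 2 * ε * (1 / Real.sqrt k) := by positivity
        linarith
      · rw [if_neg hkK, zero_add]
        have hB := hstepB k (by omega)
        have hsq : 0 < Real.sqrt k := Real.sqrt_pos.2 hk0
        have e : (k : ℝ) * s k = s k * ((k : ℝ) * Real.sqrt k) * (1 / Real.sqrt k) := by
          field_simp
        rw [e]
        exact mul_le_mul_of_nonneg_right hB (by positivity)
    have hite : ∑ k ∈ Finset.Icc 1 M, (if k ≤ K then (K : ℝ) * s 0 else 0) ≤ (K : ℝ) * K * s 0 := by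
      rw [← Finset.sum_filter, Finset.sum_const, nsmul_eq_mul]
      have hsub : (Finset.Icc 1 M).filter (fun k => k ≤ K) ⊆ Finset.Icc 1 K := by
        intro k hk
        simp only [Finset.mem_filter, Finset.mem_Icc] at hk ⊢
        omega
      have hcard : (((Finset.Icc 1 M).filter (fun k => k ≤ K)).card : ℝ) ≤ K := by
        have h1 : (((Finset.Icc 1 M).filter (fun k => k ≤ K)).card : ℝ) ≤ ((Finset.Icc 1 K).card : ℝ) := by
          exact_mod_cast Finset.card_le_card hsub
        have h2 : ((Finset.Icc 1 K).card : ℝ) = K := by simp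
        linarith
      calc (((Finset.Icc 1 M).filter (fun k => k ≤ K)).card : ℝ) * ((K : ℝ) * s 0)
          ≤ K * ((K : ℝ) * s 0) := mul_le_mul_of_nonneg_right hcard hKs0
        _ = (K : ℝ) * K * s 0 := by ring
    calc ∑ k ∈ Finset.Icc 1 M, (k : ℝ) * s k
        ≤ ∑ k ∈ Finset.Icc 1 M, ((if k ≤ K then (K : ℝ) * s 0 else 0) + 2 * ε * (1 / Real.sqrt k)) :=
          Finset.sum_le_sum hterm
      _ = ∑ k ∈ Finset.Icc 1 M, (if k ≤ K then (K : ℝ) * s 0 else 0) +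
            2 * ε * ∑ k ∈ Finset.Icc 1 M, 1 / Real.sqrt k := by
          rw [Finset.sum_add_distrib, Finset.mul_sum]
      _ ≤ (K : ℝ) * K * s 0 + 2 * ε * (2 * Real.sqrt M) :=
          add_le_add hite (mul_le_mul_of_nonneg_left (sum_Icc_one_div_sqrt_le M) (by positivity))
      _ = (K : ℝ) * K * s 0 + 4 * ε * Real.sqrt M := by ring
  -- Step D: `χ_{4n} + n∑_{k≤2n}ks_k ≤ 17εn√n` once `K²s₀ ≤ ε√n`
  obtain ⟨A, hA⟩ : ∃ A : ℝ, A = (K : ℝ) * K * s 0 := ⟨_, rfl⟩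
  have hA0 : 0 ≤ A := by rw [hA]; exact mul_nonneg (by positivity) (hs0 0)
  have hsqrt2 : ∀ n : ℕ, Real.sqrt ((2 * n : ℕ) : ℝ) ≤ 2 * Real.sqrt n := by
    intro n
    have hn : (0 : ℝ) ≤ n := Nat.cast_nonneg n
    push_cast
    calc Real.sqrt (2 * (n : ℝ)) ≤ Real.sqrt (4 * n) := Real.sqrt_le_sqrt (by linarith)
      _ = 2 * Real.sqrt n := by rw [Real.sqrt_mul (by norm_num), sqrt_four]
  have hsqrt3 : ∀ n : ℕ, Real.sqrt ((3 * n : ℕ) : ℝ) ≤ 2 * Real.sqrt n := by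
    intro n
    have hn : (0 : ℝ) ≤ n := Nat.cast_nonneg n
    push_cast
    calc Real.sqrt (3 * (n : ℝ)) ≤ Real.sqrt (4 * n) := Real.sqrt_le_sqrt (by linarith)
      _ = 2 * Real.sqrt n := by rw [Real.sqrt_mul (by norm_num), sqrt_four]
  have hsqrt4 : ∀ n : ℕ, Real.sqrt ((4 * n : ℕ) : ℝ) = 2 * Real.sqrt n := by
    intro n
    push_cast
    rw [Real.sqrt_mul (by norm_num), sqrt_four]
  have hstepD : ∀ n : ℕ, n₀ ≤ n → 1 ≤ n → A ≤ ε * Real.sqrt n →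
      χ (4 * n) + n * ∑ k ∈ Finset.Icc 1 (2 * n), (k : ℝ) * s k ≤ 17 * ε * ((n : ℝ) * Real.sqrt n) := by
    intro n hn hn1 hAn
    have hn0 : (0 : ℝ) < n := by exact_mod_cast hn1
    have h4 : χ (4 * n) ≤ 8 * ε * ((n : ℝ) * Real.sqrt n) := by
      have h := (hup (4 * n) (by omega)).le
      rw [hsqrt4 n] at h
      push_cast at h
      linarith
    have hP : ∑ k ∈ Finset.Icc 1 (2 * n), (k : ℝ) * s k ≤ A + 8 * ε * Real.sqrt n := by
      have h := hstepC (2 * n)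
      rw [← hA] at h
      have h2 := mul_le_mul_of_nonneg_left (hsqrt2 n) (by positivity : (0 : ℝ) ≤ 4 * ε)
      linarith
    have hnP : (n : ℝ) * ∑ k ∈ Finset.Icc 1 (2 * n), (k : ℝ) * s k ≤ n * (ε * Real.sqrt n + 8 * ε * Real.sqrt n) :=
      mul_le_mul_of_nonneg_left (hP.trans (by linarith)) hn0.le
    calc χ (4 * n) + n * ∑ k ∈ Finset.Icc 1 (2 * n), (k : ℝ) * s k
        ≤ 8 * ε * ((n : ℝ) * Real.sqrt n) + n * (ε * Real.sqrt n + 8 * ε * Real.sqrt n) := add_le_add h4 hnP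
      _ = 17 * ε * ((n : ℝ) * Real.sqrt n) := by ring
  -- Step E: `s_n n√n ≥ c₁/(17ε)` for such `n ≥ N₁`
  have hstepE : ∀ n : ℕ, N₁ ≤ n → n₀ ≤ n → 1 ≤ n → A ≤ ε * Real.sqrt n →
      c₁ / (17 * ε) ≤ s n * ((n : ℝ) * Real.sqrt n) := by
    intro n hN hn hn1 hAn
    have hD := hstepD n hn hn1 hAn
    have h := hdcp n hN
    rw [div_le_iff₀ (by positivity)]
    calc c₁ ≤ s n * (χ (4 * n) + n * ∑ k ∈ Finset.Icc 1 (2 * n), (k : ℝ) * s k) := h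
      _ ≤ s n * (17 * ε * ((n : ℝ) * Real.sqrt n)) := mul_le_mul_of_nonneg_left hD (hs0 n)
      _ = s n * ((n : ℝ) * Real.sqrt n) * (17 * ε) := by ring
  -- Step F: the lower bound on `χ_m`
  obtain ⟨R₁, hR₁⟩ := exists_nat_ge (A ^ 2 / ε ^ 2)
  obtain ⟨R₀, hR₀⟩ : ∃ R₀ : ℕ, R₀ = max (max N₁ n₀) (max R₁ 1) := ⟨_, rfl⟩
  have hR₀N : N₁ ≤ R₀ := by rw [hR₀]; omega
  have hR₀n : n₀ ≤ R₀ := by rw [hR₀]; omega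
  have hR₀R : R₁ ≤ R₀ := by rw [hR₀]; omega
  have hR₀1 : 1 ≤ R₀ := by rw [hR₀]; omega
  have hsqrtA : ∀ r : ℕ, R₀ ≤ r → A ≤ ε * Real.sqrt r := by
    intro r hr
    have hrR : (R₁ : ℝ) ≤ r := by exact_mod_cast hR₀R.trans hr
    have hr0 : (0 : ℝ) ≤ r := Nat.cast_nonneg r
    apply (pow_le_pow_iff_left₀ hA0 (by positivity) two_ne_zero).1
    rw [mul_pow, Real.sq_sqrt hr0]
    have h : A ^ 2 / ε ^ 2 ≤ r := hR₁.trans hrR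
    rw [div_le_iff₀ (by positivity)] at h
    linarith
  have hterm : ∀ r : ℕ, R₀ ≤ r → 4 * c₁ / (17 * ε) * Real.sqrt r ≤ 24 * ((r : ℝ) ^ 2 * s (3 * r)) := by
    intro r hr
    have hr1 : 1 ≤ r := hR₀1.trans hr
    have hr0 : (0 : ℝ) < r := by exact_mod_cast hr1
    have h3r : A ≤ ε * Real.sqrt ((3 * r : ℕ) : ℝ) := by
      refine (hsqrtA r hr).trans (mul_le_mul_of_nonneg_left (Real.sqrt_le_sqrt ?_) hε0.le)
      push_cast
      linarith
    have hE := hstepE (3 * r) (by omega) (by omega) (by omega) h3r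
    have hv : ((3 * r : ℕ) : ℝ) * Real.sqrt ((3 * r : ℕ) : ℝ) ≤ 6 * ((r : ℝ) * Real.sqrt r) := by
      have h3 := hsqrt3 r
      have h33 : ((3 * r : ℕ) : ℝ) = 3 * (r : ℝ) := by push_cast; ring
      rw [h33] at h3 ⊢
      calc 3 * (r : ℝ) * Real.sqrt (3 * (r : ℝ)) ≤ 3 * (r : ℝ) * (2 * Real.sqrt r) :=
          mul_le_mul_of_nonneg_left h3 (by positivity)
        _ = 6 * ((r : ℝ) * Real.sqrt r) := by ring
    have h1 : c₁ / (17 * ε) ≤ s (3 * r) * (6 * ((r : ℝ) * Real.sqrt r)) :=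
      hE.trans (mul_le_mul_of_nonneg_left hv (hs0 _))
    have h2 := mul_le_mul_of_nonneg_right h1 (Real.sqrt_nonneg (r : ℝ))
    have e : s (3 * r) * (6 * ((r : ℝ) * Real.sqrt r)) * Real.sqrt r = 6 * ((r : ℝ) ^ 2 * s (3 * r)) := by
      have hss : Real.sqrt (r : ℝ) * Real.sqrt r = r := Real.mul_self_sqrt hr0.le
      calc s (3 * r) * (6 * ((r : ℝ) * Real.sqrt r)) * Real.sqrt r
          = 6 * s (3 * r) * r * (Real.sqrt r * Real.sqrt r) := by ring
        _ = 6 * ((r : ℝ) ^ 2 * s (3 * r)) := by rw [hss]; ring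
    rw [e] at h2
    have e2 : 4 * c₁ / (17 * ε) * Real.sqrt r = 4 * (c₁ / (17 * ε) * Real.sqrt r) := by ring
    rw [e2]
    linarith
  have hstepF : ∀ m : ℕ, R₀ ≤ m →
      4 * c₁ / (17 * ε) * (2 / 3 * ((m : ℝ) * Real.sqrt m) - R₀ * Real.sqrt m) ≤ χ m := by
    intro m hm
    obtain ⟨κ, hκ⟩ : ∃ κ : ℝ, κ = 4 * c₁ / (17 * ε) := ⟨_, rfl⟩
    have hκ0 : 0 < κ := by rw [hκ]; positivity
    rw [← hκ]
    have hterm' : ∀ r ∈ Finset.Icc 1 m,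
        κ * Real.sqrt r - (if r < R₀ then κ * Real.sqrt r else 0) ≤ 24 * ((r : ℝ) ^ 2 * s (3 * r)) := by
      intro r _
      by_cases hrR : r < R₀
      · rw [if_pos hrR, sub_self]
        exact mul_nonneg (by norm_num) (mul_nonneg (sq_nonneg _) (hs0 _))
      · rw [if_neg hrR, sub_zero, hκ]
        exact hterm r (not_lt.1 hrR)
    have hsum := Finset.sum_le_sum hterm'
    rw [Finset.sum_sub_distrib, ← Finset.mul_sum, ← Finset.mul_sum] at hsum
    have hite : ∑ r ∈ Finset.Icc 1 m, (if r < R₀ then κ * Real.sqrt r else 0) ≤ (R₀ : ℝ) * (κ * Real.sqrt m) := by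
      rw [← Finset.sum_filter]
      calc ∑ r ∈ (Finset.Icc 1 m).filter (fun r => r < R₀), κ * Real.sqrt r
          ≤ ∑ _r ∈ (Finset.Icc 1 m).filter (fun r => r < R₀), κ * Real.sqrt m := by
            refine Finset.sum_le_sum fun r hr => ?_
            have hrm : (r : ℝ) ≤ m := by exact_mod_cast (Finset.mem_Icc.1 (Finset.mem_filter.1 hr).1).2
            exact mul_le_mul_of_nonneg_left (Real.sqrt_le_sqrt hrm) hκ0.le
        _ = (((Finset.Icc 1 m).filter (fun r => r < R₀)).card : ℝ) * (κ * Real.sqrt m) := by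
            rw [Finset.sum_const, nsmul_eq_mul]
        _ ≤ R₀ * (κ * Real.sqrt m) := by
            apply mul_le_mul_of_nonneg_right _ (by positivity)
            have hsub : (Finset.Icc 1 m).filter (fun r => r < R₀) ⊆ Finset.range R₀ := by
              intro r hr
              simp only [Finset.mem_filter, Finset.mem_Icc, Finset.mem_range] at hr ⊢
              omega
            have h1 : (((Finset.Icc 1 m).filter (fun r => r < R₀)).card : ℝ) ≤ ((Finset.range R₀).card : ℝ) := by
              exact_mod_cast Finset.card_le_card hsub
            have h2 : ((Finset.range R₀).card : ℝ) = R₀ := by rw [Finset.card_range]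
            linarith
    have hχ := hχs m
    have h23 := two_thirds_mul_sqrt_le_sum_Icc_sqrt m
    have hκS : κ * (2 / 3 * ((m : ℝ) * Real.sqrt m)) ≤ κ * ∑ r ∈ Finset.Icc 1 m, Real.sqrt r :=
      mul_le_mul_of_nonneg_left h23 hκ0.le
    nlinarith [hsum, hχ, hκS, hite]
  -- the contradiction at `m = max (3R₀) (max n₀ 1)`
  obtain ⟨m, hm⟩ : ∃ m : ℕ, m = max (3 * R₀) (max n₀ 1) := ⟨_, rfl⟩
  have hm1 : 1 ≤ m := by rw [hm]; omega
  have hmR : 3 * R₀ ≤ m := by rw [hm]; omega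
  have hmn : n₀ ≤ m := by rw [hm]; omega
  have hm0 : (0 : ℝ) < m := by exact_mod_cast hm1
  have hF := hstepF m (by omega)
  have hU := hup m hmn
  have hR3 : (R₀ : ℝ) * Real.sqrt m ≤ 1 / 3 * ((m : ℝ) * Real.sqrt m) := by
    have h : 3 * (R₀ : ℝ) ≤ m := by exact_mod_cast hmR
    have hs := Real.sqrt_nonneg (m : ℝ)
    nlinarith
  have hw : 0 < (m : ℝ) * Real.sqrt m := by positivity
  have hκε : 4 * c₁ / (17 * ε) * (1 / 3 * ((m : ℝ) * Real.sqrt m)) < ε * ((m : ℝ) * Real.sqrt m) := by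
    calc 4 * c₁ / (17 * ε) * (1 / 3 * ((m : ℝ) * Real.sqrt m))
        ≤ 4 * c₁ / (17 * ε) * (2 / 3 * ((m : ℝ) * Real.sqrt m) - R₀ * Real.sqrt m) := by
          apply mul_le_mul_of_nonneg_left _ (by positivity)
          linarith
      _ ≤ χ m := hF
      _ < ε * ((m : ℝ) * Real.sqrt m) := hU
  have h1 : 4 * c₁ / (17 * ε) * (1 / 3) < ε := by
    have h2 : 4 * c₁ / (17 * ε) * (1 / 3) * ((m : ℝ) * Real.sqrt m) < ε * ((m : ℝ) * Real.sqrt m) := by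
      calc 4 * c₁ / (17 * ε) * (1 / 3) * ((m : ℝ) * Real.sqrt m)
          = 4 * c₁ / (17 * ε) * (1 / 3 * ((m : ℝ) * Real.sqrt m)) := by ring
        _ < ε * ((m : ℝ) * Real.sqrt m) := hκε
    exact lt_of_mul_lt_mul_right h2 hw.le
  rw [div_mul_eq_mul_div, div_lt_iff₀ (by positivity)] at h1
  nlinarith [hε2, hc₁]


/-! ### From the lattice to the sequences -/

section Model

variable (J : Site 3 → Site 3 → ℝ) (β : ℝ)

/-- **Shell decomposition of the box susceptibility**:
`χ_m = χ_0 + ∑_{r=1}^{m} ∑_{x ∈ Λ_r ∖ Λ_{r-1}} ⟨σ₀σ_x⟩`. [folklore] -/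
theorem boxSusceptibility_eq_sum_shells (m : ℕ) :
    boxSusceptibility J β m = boxSusceptibility J β 0 +
      ∑ r ∈ Finset.Icc 1 m, ∑ x ∈ box 3 r \ box 3 (r - 1), pairCorrelation J β 0 x := by
  induction m with
  | zero => simp
  | succ n ih =>
    rw [Finset.sum_Icc_succ_top (Nat.le_add_left 1 n), ← add_assoc, ← ih, Nat.add_sub_cancel,
      boxSusceptibility, boxSusceptibility, ← Finset.sum_sdiff (box_mono 3 (Nat.le_succ n))]
    ring

/-- **A shell sum from below**: if `c ≤ g(x)` on the sphere `‖x‖_∞ = r` (`r ≥ 1`, `c ≥ 0`), then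
`24r²c ≤ ∑_{x ∈ Λ_r ∖ Λ_{r-1}} g(x)` — the shell has `(2r+1)³ - (2r-1)³ = 24r² + 2` sites. [folklore] -/
theorem mul_le_sum_shell {r : ℕ} (hr : 1 ≤ r) {g : Site 3 → ℝ} {c : ℝ} (hc : 0 ≤ c)
    (hg : ∀ x : Site 3, Site.supNorm x = r → c ≤ g x) :
    24 * (r : ℝ) ^ 2 * c ≤ ∑ x ∈ box 3 r \ box 3 (r - 1), g x := by
  have hsub : box 3 (r - 1) ⊆ box 3 r := box_mono 3 (Nat.sub_le r 1)
  have hmem : ∀ x ∈ box 3 r \ box 3 (r - 1), Site.supNorm x = r := by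
    intro x hx
    rw [Finset.mem_sdiff, mem_box_iff_supNorm_le, mem_box_iff_supNorm_le] at hx
    omega
  have hcard : ((box 3 r \ box 3 (r - 1)).card : ℝ) = (2 * (r : ℝ) + 1) ^ 3 - (2 * ((r : ℝ) - 1) + 1) ^ 3 := by
    have h := Finset.card_sdiff_add_card_eq_card hsub
    rw [card_box, card_box] at h
    have h' : ((box 3 r \ box 3 (r - 1)).card : ℝ) + ((2 * (r - 1) + 1) ^ 3 : ℕ) = ((2 * r + 1) ^ 3 : ℕ) := by
      exact_mod_cast h
    push_cast [Nat.cast_sub hr] at h'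
    linarith
  have h24 : 24 * (r : ℝ) ^ 2 ≤ ((box 3 r \ box 3 (r - 1)).card : ℝ) := by
    rw [hcard]
    nlinarith
  calc 24 * (r : ℝ) ^ 2 * c ≤ ((box 3 r \ box 3 (r - 1)).card : ℝ) * c :=
      mul_le_mul_of_nonneg_right h24 hc
    _ = ∑ _x ∈ box 3 r \ box 3 (r - 1), c := by rw [Finset.sum_const, nsmul_eq_mul]
    _ ≤ ∑ x ∈ box 3 r \ box 3 (r - 1), g x := Finset.sum_le_sum fun x hx => hg x (hmem x hx)

/-- **MMS (ii) summed over shells**: if `⟨σ₀σ_x⟩ ≥ ⟨σ₀σ_{3‖x‖_∞e₁}⟩` for all `x` (which the printed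
MMS inequalities give through `⟨σ₀σ_x⟩ ≥ ⟨σ₀σ_{|x|₁e₁}⟩`, `|x|₁ ≤ 3‖x‖_∞` on `ℤ³` and the monotonicity
of `k ↦ ⟨σ₀σ_{ke₁}⟩`), then `24∑_{r=1}^{m} r²⟨σ₀σ_{3re₁}⟩ ≤ χ_m`.
[cite: DuminilCopinPanis2025LowerBounds, §1 (footnote on the MMS inequalities)] -/
theorem shellSum_le_boxSusceptibility (hβ : 0 ≤ β) (hJ : ∀ x y, 0 ≤ J x y)
    (hlow : ∀ x : Site 3, pairCorrelation J β 0 (Pi.single 0 ((3 * Site.supNorm x : ℕ) : ℤ)) ≤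
      pairCorrelation J β 0 x)
    (m : ℕ) :
    24 * ∑ r ∈ Finset.Icc 1 m, (r : ℝ) ^ 2 * pairCorrelation J β 0 (Pi.single 0 ((3 * r : ℕ) : ℤ)) ≤
      boxSusceptibility J β m := by
  rw [boxSusceptibility_eq_sum_shells J β m, Finset.mul_sum]
  have h0 : 0 ≤ boxSusceptibility J β 0 := boxSusceptibility_nonneg J β hβ hJ 0
  have h1 : ∀ r ∈ Finset.Icc 1 m,
      24 * ((r : ℝ) ^ 2 * pairCorrelation J β 0 (Pi.single 0 ((3 * r : ℕ) : ℤ))) ≤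
        ∑ x ∈ box 3 r \ box 3 (r - 1), pairCorrelation J β 0 x := by
    intro r hr
    have hr1 : 1 ≤ r := (Finset.mem_Icc.1 hr).1
    have h := mul_le_sum_shell hr1 (pairCorrelation_nonneg J β hβ hJ 0 (Pi.single 0 ((3 * r : ℕ) : ℤ)))
      (g := pairCorrelation J β 0) (fun x hx => by rw [← hx]; exact hlow x)
    linarith
  calc ∑ r ∈ Finset.Icc 1 m, 24 * ((r : ℝ) ^ 2 * pairCorrelation J β 0 (Pi.single 0 ((3 * r : ℕ) : ℤ)))
      ≤ ∑ r ∈ Finset.Icc 1 m, ∑ x ∈ box 3 r \ box 3 (r - 1), pairCorrelation J β 0 x := Finset.sum_le_sum h1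
    _ ≤ boxSusceptibility J β 0 +
        ∑ r ∈ Finset.Icc 1 m, ∑ x ∈ box 3 r \ box 3 (r - 1), pairCorrelation J β 0 x := le_add_of_nonneg_left h0

end Model

/-- **A ferromagnet on `ℤ³` satisfying the Duminil-Copin–Panis lower bound at `β` has `χ_L(β)² ≥ cL³`
for some `c > 0` and infinitely many `L`.** Hypotheses (`J ≥ 0`, `β ≥ 0`, on-axis sites `ke₁ = Pi.single 0 k`):
(i) `k ↦ ⟨σ₀σ_{ke₁}⟩_β` is antitone; (ii) `⟨σ₀σ_x⟩_β ≥ ⟨σ₀σ_{3‖x‖_∞e₁}⟩_β` — for the nearest-neighbour model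
both are the Messager–Miracle-Solé inequalities "(i) the sequence `(⟨τ₀τ_{ke₁}⟩_β)_{k≥0}` is decreasing;
(ii) … `⟨τ₀τ_{(|x|₁,0_⊥)}⟩_β ≤ ⟨τ₀τ_x⟩_β`" (with `|x|₁ ≤ 3‖x‖_∞` on `ℤ³`); (iii) the lower bound
"`⟨τ₀τ_{ne₁}⟩_β ≥ c₁/(χ_{4n}(β) + n^{d-2}∑_{1≤k≤2n}k⟨τ₀τ_{ke₁}⟩_β)`" for `n ≥ N₁`, `d = 3` — Theorem 1.3
of Duminil-Copin–Panis for the nearest-neighbour model, for all `N₁ ≤ n ≤ L(β)`, hence for all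
`n ≥ N₁` at `β = β_c` where the sharp length is infinite. Conclusion: the necessary condition for a
non-Gaussian critical smearing isolated by the generation-4 audit of `LongRangeTrivialityOnZ3`
(`hasNonGaussianSmearingZ3_member_imp_frequently` in `LongRangeTrivialityOnZ3SusceptibilityAudit.lean`) —
the nearest-neighbour model on `ℤ³` is NOT in the reach of the tree-diagram mechanism. (The three
hypotheses are printed theorems for the nearest-neighbour DLR state; they are hypotheses here because that
state and `LongRangeIsing.state (nnCoupling 3)` are not bridged in the tree.)
[cite: DuminilCopinPanis2025LowerBounds, Theorem 1.3, Theorem 1.5 and §1 (footnote on the MMS inequalities)] -/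
theorem frequently_boxSusceptibility_sq_ge_of_dcp {J : Site 3 → Site 3 → ℝ} {β : ℝ} (hβ : 0 ≤ β)
    (hJ : ∀ x y, 0 ≤ J x y)
    (hmono : Antitone fun k : ℕ => pairCorrelation J β 0 (Pi.single 0 (k : ℤ)))
    (hlow : ∀ x : Site 3, pairCorrelation J β 0 (Pi.single 0 ((3 * Site.supNorm x : ℕ) : ℤ)) ≤
      pairCorrelation J β 0 x)
    {c₁ : ℝ} (hc₁ : 0 < c₁) {N₁ : ℕ}
    (hdcp : ∀ n : ℕ, N₁ ≤ n → c₁ ≤ pairCorrelation J β 0 (Pi.single 0 (n : ℤ)) *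
      (boxSusceptibility J β (4 * n) +
        n * ∑ k ∈ Finset.Icc 1 (2 * n), (k : ℝ) * pairCorrelation J β 0 (Pi.single 0 (k : ℤ)))) :
    ∃ c : ℝ, 0 < c ∧ ∃ᶠ m : ℕ in atTop, c * (m : ℝ) ^ 3 ≤ boxSusceptibility J β m ^ 2 :=
  frequently_sq_le_of_dcp_lowerBound (s := fun k : ℕ => pairCorrelation J β 0 (Pi.single 0 (k : ℤ)))
    (χ := boxSusceptibility J β) hc₁ (fun _ => pairCorrelation_nonneg J β hβ hJ 0 _) hmono
    (fun m => shellSum_le_boxSusceptibility J β hβ hJ hlow m) hdcp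

end LongRangeIsing

end Literature.Barriers.CriticalPhenomena

end
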